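import Mathlib
import Literature.NumberTheory.Sieve.Maynard2016SystemCRT
import Literature.NumberTheory.Sieve.Maynard2016LocalSystem
import HarnessLib

/-!
# Maynard 2016: `#{n ≤ N : n ≡ α (P_w), d_j ∣ n + c_j, e_j ∣ m(n + c_j) − 1 (j ≤ k)} = N/(P_w ∏ d_j e_j) + O(1)`

Topic `Literature/NumberTheory/Sieve`. J. Maynard, *Large gaps between primes*, Ann. of Math. (2)
183 (2016), 915–933 = arXiv:1408.5110, §6 displays (6.7)–(6.8) (proof of Lemma 6) and
(6.24)–(6.25) (proof of Lemma 7): in a fixed class `n ≡ α (mod P_w)`, the inner count of the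
expanded Selberg square — `n ≤ N` with `d_j ∣ n + h_j q` and `e_j ∣ m(n + h_j q) − 1` for all
`j`, the moduli `d_j e_j` pairwise coprime and coprime to `P_w`, `(m, e_j) = 1` — is
`N/(P_w ∏_j d_j e_j) + O(1)` "by the Chinese remainder theorem". This is the 2016 form of the
single-class count `MaynardSieveCounting.abs_cnt_sub_le` of the tree's Maynard-2015 development.

PROVED here (no named facts): `periodic_localSystem`, `card_filter_range_system_eq_one` and the
count `abs_card_class_system_sub_le` (error `≤ 1`), assembled from `Maynard2016ClassCRT`,
`Maynard2016LocalSystem`, `Maynard2016SystemCRT`.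

## References

* J. Maynard, *Large gaps between primes*, Ann. of Math. (2) 183 (2016), 915–933; arXiv:1408.5110,
  §6 (6.7)–(6.8), (6.24)–(6.25). [Maynard2016LargeGaps]
-/

open Filter Finset
open scoped Topology

namespace Literature.NumberTheory.Sieve

namespace Maynard2016

/-- The local system `a ∣ n + c ∧ b ∣ m(n + c) − 1` is `ab`-periodic (`c ≥ 1`). [cite: Maynard2016LargeGaps, §6 display (6.8)] -/
theorem periodic_localSystem (a b m : ℕ) {c : ℕ} (hc : 1 ≤ c) :
    Function.Periodic (fun n => a ∣ n + c ∧ b ∣ m * (n + c) - 1) (a * b) := by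
  intro n
  have h1 : (a ∣ (n + b * a) + c) = (a ∣ n + c) := by
    have := (periodic_dvd_add a c).nsmul b n
    rwa [smul_eq_mul] at this
  have h2 : (b ∣ m * ((n + a * b) + c) - 1) = (b ∣ m * (n + c) - 1) := by
    have := (periodic_dvd_mul_add_sub_one b m hc).nsmul a n
    rwa [smul_eq_mul] at this
  rw [mul_comm b a] at h1
  show (a ∣ n + a * b + c ∧ b ∣ m * (n + a * b + c) - 1) = (a ∣ n + c ∧ b ∣ m * (n + c) - 1)
  rw [h1, h2]

/-- **The system has exactly one solution modulo `∏_j a_j b_j`.** (`a_j b_j` pairwise coprime,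
`(a_j, b_j) = 1`, `(m, b_j) = 1`, `c_j ≥ 1`.) [cite: Maynard2016LargeGaps, §6 displays (6.7)–(6.8) («by the Chinese remainder theorem»)] -/
theorem card_filter_range_system_eq_one {k : ℕ} (a b c : Fin k → ℕ) (m : ℕ)
    (ha : ∀ j, 0 < a j) (hb : ∀ j, 0 < b j) (hab : ∀ j, (a j).Coprime (b j))
    (hmb : ∀ j, m.Coprime (b j)) (hc : ∀ j, 1 ≤ c j)
    (hpair : Pairwise fun i j => (a i * b i).Coprime (a j * b j)) :
    ((Finset.range (∏ j, a j * b j)).filter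
        (fun n => ∀ j ∈ (Finset.univ : Finset (Fin k)), a j ∣ n + c j ∧ b j ∣ m * (n + c j) - 1)).card = 1 := by
  have h := card_filter_range_prod_of_pairwise_coprime (Finset.univ : Finset (Fin k))
    (fun j => a j * b j) (fun j n => a j ∣ n + c j ∧ b j ∣ m * (n + c j) - 1)
    (fun j _ => Nat.mul_pos (ha j) (hb j))
    (by rw [Finset.coe_univ]; exact Set.pairwise_univ.2 hpair)
    (fun j _ => periodic_localSystem (a j) (b j) m (hc j))
  rw [Finset.prod_eq_one (fun j _ =>
    card_filter_range_local_system (ha j) (hb j) (hab j) (hmb j) (hc j))] at h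
  convert h using 2
  ext n
  simp only [Finset.mem_filter]

/-- **The class-and-system count.** For `P ≥ 1` coprime to `∏_j a_j b_j`, `α < P`, and a system as
in `card_filter_range_system_eq_one`:
`| #{1 ≤ n ≤ N : n ≡ α (mod P), ∀ j: a_j ∣ n + c_j, b_j ∣ m(n + c_j) − 1} − N/(P ∏_j a_j b_j) | ≤ 1`.
[cite: Maynard2016LargeGaps, §6 displays (6.7)–(6.8), (6.24)–(6.25)] -/
theorem abs_card_class_system_sub_le {k : ℕ} {P : ℕ} (hP : 0 < P) {α : ℕ} (hα : α < P)
    (a b c : Fin k → ℕ) (m : ℕ) (ha : ∀ j, 0 < a j) (hb : ∀ j, 0 < b j)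
    (hab : ∀ j, (a j).Coprime (b j)) (hmb : ∀ j, m.Coprime (b j)) (hc : ∀ j, 1 ≤ c j)
    (hpair : Pairwise fun i j => (a i * b i).Coprime (a j * b j))
    (hPD : P.Coprime (∏ j, a j * b j)) (N : ℕ) :
    |(((Finset.Icc 1 N).filter (fun n => n % P = α ∧
        ∀ j ∈ (Finset.univ : Finset (Fin k)), a j ∣ n + c j ∧ b j ∣ m * (n + c j) - 1)).card : ℝ) -
        (N : ℝ) / ((P : ℝ) * ∏ j, ((a j * b j : ℕ) : ℝ))| ≤ 1 := by
  have hD : 0 < ∏ j, a j * b j := Finset.prod_pos fun j _ => Nat.mul_pos (ha j) (hb j)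
  have hper : Function.Periodic
      (fun n => ∀ j ∈ (Finset.univ : Finset (Fin k)), a j ∣ n + c j ∧ b j ∣ m * (n + c j) - 1)
      (∏ j, a j * b j) :=
    periodic_forall_of_dvd Finset.univ (fun j => a j * b j)
      (fun j n => a j ∣ n + c j ∧ b j ∣ m * (n + c j) - 1)
      (fun j _ => periodic_localSystem (a j) (b j) m (hc j)) (fun j hj => Finset.dvd_prod_of_mem _ hj)
  have h := abs_card_class_and_sub_le hP hD hPD hα
    (fun n => ∀ j ∈ (Finset.univ : Finset (Fin k)), a j ∣ n + c j ∧ b j ∣ m * (n + c j) - 1) hper N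
  have hr : ((Finset.range (∏ j, a j * b j)).filter (fun n =>
      ∀ j ∈ (Finset.univ : Finset (Fin k)), a j ∣ n + c j ∧ b j ∣ m * (n + c j) - 1)).card = 1 := by
    convert card_filter_range_system_eq_one a b c m ha hb hab hmb hc hpair using 2
  rw [hr] at h
  have hcast : ((∏ j, a j * b j : ℕ) : ℝ) = ∏ j, ((a j * b j : ℕ) : ℝ) := by push_cast; rfl
  simpa [hcast] using h

end Maynard2016

end Literature.NumberTheory.Sieve
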